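import Literature.NumberTheory.Sieve.GoldstonPintzYildirimTwoVarEuler
import HarnessLib

/-!
# Euler products of double Dirichlet series with pair-multiplicative terms

Trunk: NumberTheory / Sieve. A generic form of the mechanism of GPY (7.8)/(9.16)
(D. A. Goldston, J. Pintz, C. Y. Yıldırım, *Primes in tuples. I*, Ann. of Math. 170 (2009) =
arXiv:math/0508185, §7 p. 14 and §9 p. 19): a family `t : ℕ × ℕ → ℂ` indexed by pairs `(d, e)`
which is

* normalised, `t(1,1) = 1`;
* PAIR-MULTIPLICATIVE: `t(d₁d₂, e₁e₂) = t(d₁,e₁) t(d₂,e₂)` whenever `d₁, e₁ ∣ m`, `d₂, e₂ ∣ n`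
  with `(m, n) = 1`;
* supported on pairs with squarefree `[d, e]` (as are all terms carrying `μ(d)μ(e)`);
* absolutely summable, and `0` on the pairs with `d = 0` or `e = 0`,

regroups along `q = [d, e]` into a multiplicative, absolutely summable arithmetic function
`pairFiberSum t q = ∑_{[d,e] = q} t(d,e)` vanishing at prime powers `p^k`, `k ≥ 2`, whence

  `∑_{d,e} t(d,e) = ∏_p (1 + t(p,1) + t(1,p) + t(p,p))`   (`hasProd_one_add_pair`).

`GoldstonPintzYildirimTwoVarEuler` proves exactly this for the terms of GPY's `F(s₁,s₂)` ((7.8));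
the present file abstracts its argument (reusing its combinatorial lemmas `lcmFiber`,
`lcm_mul_mul_of_coprime`, `sum_divisors_mul_eq`, `mul_eq_mul_iff_of_dvd`, `hasSum_sum_lcmFiber`) so
that the `φ`-weighted series of §9 ((9.16), `GoldstonPintzYildirimThetaDirichlet`) — and any other
pair-multiplicative family — is covered by instantiation. Everything here is PROVED.

## References

* D. A. Goldston, J. Pintz, C. Y. Yıldırım, *Primes in tuples. I*, Ann. of Math. (2) 170 (2009),
  819–862 = arXiv:math/0508185, §7 (7.8), p. 14; §9 (9.16), p. 19. [cite: GoldstonPintzYildirim2009]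
-/

noncomputable section

open Finset

namespace Literature.NumberTheory.Sieve.GPY

/-- The fibre sums `∑_{[d,e] = q} t(d,e)` of a family indexed by pairs (the arithmetic function of
`q` obtained by grouping the terms of `∑_{d,e} t(d,e)` according to `q = [d,e]`; GPY's
`q = a₁a₂a₁₂`). [cite: GoldstonPintzYildirim2009, Section 7 eq. 7.8] -/
def pairFiberSum (t : ℕ × ℕ → ℂ) (q : ℕ) : ℂ := ∑ p ∈ lcmFiber q, t p

/-- The hypothesis "pair-multiplicative": `t(d₁d₂, e₁e₂) = t(d₁,e₁) t(d₂,e₂)` for `d₁, e₁ ∣ m`,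
`d₂, e₂ ∣ n`, `(m, n) = 1`. [cite: GoldstonPintzYildirim2009, Section 7 eq. 7.8] -/
def IsPairMultiplicative (t : ℕ × ℕ → ℂ) : Prop :=
  ∀ ⦃m n d₁ e₁ d₂ e₂ : ℕ⦄, m.Coprime n → d₁ ∣ m → e₁ ∣ m → d₂ ∣ n → e₂ ∣ n →
    t (d₁ * d₂, e₁ * e₂) = t (d₁, e₁) * t (d₂, e₂)

variable {t : ℕ × ℕ → ℂ}

/-- `pairFiberSum t 0 = 0`. [folklore] -/
theorem pairFiberSum_zero (t : ℕ × ℕ → ℂ) : pairFiberSum t 0 = 0 := by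
  simp [pairFiberSum, lcmFiber_zero]

/-- `pairFiberSum t 1 = t(1,1)` (the fibre is `{(1,1)}`). [folklore] -/
theorem pairFiberSum_one (t : ℕ × ℕ → ℂ) : pairFiberSum t 1 = t (1, 1) := by
  have h : lcmFiber 1 = {(1, 1)} := by
    ext ⟨d, e⟩
    rw [mem_lcmFiber one_ne_zero, Finset.mem_singleton, Prod.mk.injEq]
    constructor
    · intro h
      exact ⟨Nat.eq_one_of_dvd_one (h ▸ Nat.dvd_lcm_left d e),
        Nat.eq_one_of_dvd_one (h ▸ Nat.dvd_lcm_right d e)⟩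
    · rintro ⟨rfl, rfl⟩; simp
  rw [pairFiberSum, h, Finset.sum_singleton]

/-- **Multiplicativity of the fibre sums**: `pairFiberSum t (mn) = pairFiberSum t m · pairFiberSum t n`
for `(m, n) = 1` and pair-multiplicative `t` (the proof of `lcmFiberSum_mul_of_coprime` verbatim).
[cite: GoldstonPintzYildirim2009, Section 7 eq. 7.8] -/
theorem pairFiberSum_mul_of_coprime (ht : IsPairMultiplicative t) {m n : ℕ} (hmn : m.Coprime n) :
    pairFiberSum t (m * n) = pairFiberSum t m * pairFiberSum t n := by
  rcases Nat.eq_zero_or_pos m with rfl | hm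
  · simp [pairFiberSum_zero]
  rcases Nat.eq_zero_or_pos n with rfl | hn
  · simp [pairFiberSum_zero]
  have hind : ∀ q : ℕ, pairFiberSum t q =
      ∑ d ∈ q.divisors, ∑ e ∈ q.divisors, if Nat.lcm d e = q then t (d, e) else 0 := by
    intro q
    rw [pairFiberSum, lcmFiber, Finset.sum_filter, Finset.sum_product]
  rw [hind, hind, hind, sum_divisors_mul_eq hmn]
  simp_rw [sum_divisors_mul_eq hmn]
  have hfac : ∀ d₁ ∈ m.divisors, ∀ d₂ ∈ n.divisors, ∀ e₁ ∈ m.divisors, ∀ e₂ ∈ n.divisors,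
      (if Nat.lcm (d₁ * d₂) (e₁ * e₂) = m * n then t (d₁ * d₂, e₁ * e₂) else 0) =
        (if Nat.lcm d₁ e₁ = m then t (d₁, e₁) else 0) *
          (if Nat.lcm d₂ e₂ = n then t (d₂, e₂) else 0) := by
    intro d₁ hd₁ d₂ hd₂ e₁ he₁ e₂ he₂
    have hd₁' := Nat.dvd_of_mem_divisors hd₁
    have hd₂' := Nat.dvd_of_mem_divisors hd₂
    have he₁' := Nat.dvd_of_mem_divisors he₁
    have he₂' := Nat.dvd_of_mem_divisors he₂
    rw [lcm_mul_mul_of_coprime hmn hd₁' he₁' hd₂' he₂']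
    have hiff := mul_eq_mul_iff_of_dvd hm.ne' hn.ne' (Nat.lcm_dvd hd₁' he₁') (Nat.lcm_dvd hd₂' he₂')
    by_cases h1 : Nat.lcm d₁ e₁ = m
    · by_cases h2 : Nat.lcm d₂ e₂ = n
      · rw [if_pos (hiff.2 ⟨h1, h2⟩), if_pos h1, if_pos h2, ht hmn hd₁' he₁' hd₂' he₂']
      · rw [if_neg (fun h => h2 (hiff.1 h).2), if_neg h2, mul_zero]
    · rw [if_neg (fun h => h1 (hiff.1 h).1), if_neg h1, zero_mul]
  calc ∑ d₁ ∈ m.divisors, ∑ d₂ ∈ n.divisors, ∑ e₁ ∈ m.divisors, ∑ e₂ ∈ n.divisors,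
        (if Nat.lcm (d₁ * d₂) (e₁ * e₂) = m * n then t (d₁ * d₂, e₁ * e₂) else 0)
      = ∑ d₁ ∈ m.divisors, ∑ d₂ ∈ n.divisors, ∑ e₁ ∈ m.divisors, ∑ e₂ ∈ n.divisors,
          (if Nat.lcm d₁ e₁ = m then t (d₁, e₁) else 0) *
            (if Nat.lcm d₂ e₂ = n then t (d₂, e₂) else 0) := by
        refine Finset.sum_congr rfl fun d₁ hd₁ => Finset.sum_congr rfl fun d₂ hd₂ =>
          Finset.sum_congr rfl fun e₁ he₁ => Finset.sum_congr rfl fun e₂ he₂ => ?_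
        exact hfac d₁ hd₁ d₂ hd₂ e₁ he₁ e₂ he₂
    _ = ∑ d₁ ∈ m.divisors, ∑ e₁ ∈ m.divisors, ∑ d₂ ∈ n.divisors, ∑ e₂ ∈ n.divisors,
          (if Nat.lcm d₁ e₁ = m then t (d₁, e₁) else 0) *
            (if Nat.lcm d₂ e₂ = n then t (d₂, e₂) else 0) := by
        refine Finset.sum_congr rfl fun d₁ _ => ?_
        rw [Finset.sum_comm]
    _ = (∑ d₁ ∈ m.divisors, ∑ e₁ ∈ m.divisors, if Nat.lcm d₁ e₁ = m then t (d₁, e₁) else 0) *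
          ∑ d₂ ∈ n.divisors, ∑ e₂ ∈ n.divisors, if Nat.lcm d₂ e₂ = n then t (d₂, e₂) else 0 := by
        rw [Finset.sum_mul]
        refine Finset.sum_congr rfl fun d₁ _ => ?_
        rw [Finset.sum_mul]
        refine Finset.sum_congr rfl fun e₁ _ => ?_
        rw [Finset.mul_sum]
        refine Finset.sum_congr rfl fun d₂ _ => ?_
        rw [Finset.mul_sum]

/-- `pairFiberSum t (p^k) = 0` for `k ≥ 2` when `t` is supported on pairs with squarefree `[d,e]`.
[folklore] -/
theorem pairFiberSum_prime_pow (hsq : ∀ p : ℕ × ℕ, t p ≠ 0 → Squarefree (Nat.lcm p.1 p.2))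
    {p : ℕ} (hp : p.Prime) {k : ℕ} (hk : 2 ≤ k) : pairFiberSum t (p ^ k) = 0 := by
  refine Finset.sum_eq_zero fun q hq => ?_
  rw [mem_lcmFiber (pow_ne_zero k hp.ne_zero)] at hq
  by_contra hne
  have hsq' := hsq q hne
  rw [hq] at hsq'
  have h2 : p * p ∣ p ^ k := by
    rw [← sq]; exact pow_dvd_pow p hk
  exact hp.one_lt.ne' (Nat.isUnit_iff.1 (hsq' p h2))

/-- **The fibre sum at a prime**: `pairFiberSum t p = t(p,1) + t(1,p) + t(p,p)` (the fibre is
`{(p,1), (1,p), (p,p)}`). [cite: GoldstonPintzYildirim2009, Section 7 eq. 7.8] -/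
theorem pairFiberSum_prime (t : ℕ × ℕ → ℂ) {p : ℕ} (hp : p.Prime) :
    pairFiberSum t p = t (p, 1) + t (1, p) + t (p, p) := by
  have hp1 : (1 : ℕ) ≠ p := hp.one_lt.ne
  have hfib : pairFiberSum t p =
      ∑ d ∈ ({1, p} : Finset ℕ), ∑ e ∈ ({1, p} : Finset ℕ),
        if Nat.lcm d e = p then t (d, e) else 0 := by
    rw [pairFiberSum, lcmFiber, Finset.sum_filter, Finset.sum_product, hp.divisors]
  rw [hfib, Finset.sum_pair hp1, Finset.sum_pair hp1, Finset.sum_pair hp1]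
  have h11 : ¬ Nat.lcm 1 1 = p := by rw [Nat.lcm_self]; exact hp1
  rw [if_neg h11, if_pos (Nat.lcm_one_left p), if_pos (Nat.lcm_one_right p), if_pos (Nat.lcm_self p)]
  ring

/-- **Fibrewise resummation**: `∑_q pairFiberSum t q = ∑_{d,e} t(d,e)` for an absolutely summable
family vanishing on the pairs with `d = 0` or `e = 0`.
[cite: GoldstonPintzYildirim2009, Section 7 eq. 7.8] -/
theorem hasSum_pairFiberSum (hs : Summable t) (h0 : ∀ p : ℕ × ℕ, Nat.lcm p.1 p.2 = 0 → t p = 0) :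
    HasSum (pairFiberSum t) (∑' p : ℕ × ℕ, t p) :=
  hasSum_sum_lcmFiber hs.hasSum h0

/-- `∑_q ‖pairFiberSum t q‖ < ∞` (the resummation applied to the norms).
[cite: GoldstonPintzYildirim2009, Section 7 eq. 7.8] -/
theorem summable_norm_pairFiberSum (hs : Summable fun p => ‖t p‖)
    (h0 : ∀ p : ℕ × ℕ, Nat.lcm p.1 p.2 = 0 → t p = 0) :
    Summable fun q : ℕ => ‖pairFiberSum t q‖ := by
  have hN : Summable fun p : ℕ × ℕ => ((‖t p‖ : ℝ) : ℂ) := Complex.ofRealCLM.summable hs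
  have hfib := hasSum_sum_lcmFiber hN.hasSum (fun p hp => by
    rw [h0 p hp, norm_zero, Complex.ofReal_zero])
  have hre : Summable fun q : ℕ => ∑ p ∈ lcmFiber q, ‖t p‖ := by
    have := (Complex.reCLM.summable hfib.summable)
    refine this.congr fun q => ?_
    simp
  refine Summable.of_nonneg_of_le (fun q => norm_nonneg _) (fun q => ?_) hre
  exact norm_sum_le _ _

/-- **The Euler product of a pair-multiplicative family**: if `t(1,1) = 1`, `t` is
pair-multiplicative, supported on pairs with squarefree `[d,e]`, absolutely summable and `0` on the
pairs with a zero entry, then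
`HasProd (p ↦ 1 + t(p,1) + t(1,p) + t(p,p)) (∑_{d,e} t(d,e))` (Mathlib's
`EulerProduct.eulerProduct_hasProd` for the multiplicative `q ↦ pairFiberSum t q`).
[cite: GoldstonPintzYildirim2009, Section 7 eq. 7.8] -/
theorem hasProd_one_add_pair (h1 : t (1, 1) = 1) (ht : IsPairMultiplicative t)
    (hsq : ∀ p : ℕ × ℕ, t p ≠ 0 → Squarefree (Nat.lcm p.1 p.2)) (hs : Summable fun p => ‖t p‖)
    (h0 : ∀ p : ℕ × ℕ, Nat.lcm p.1 p.2 = 0 → t p = 0) :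
    HasProd (fun p : Nat.Primes => 1 + t (p, 1) + t (1, p) + t (p, p)) (∑' p : ℕ × ℕ, t p) := by
  have hone : pairFiberSum t 1 = 1 := by rw [pairFiberSum_one, h1]
  have h := EulerProduct.eulerProduct_hasProd (f := pairFiberSum t) hone
    (fun hab => pairFiberSum_mul_of_coprime ht hab) (summable_norm_pairFiberSum hs h0)
    (pairFiberSum_zero t)
  have hloc : ∀ p : Nat.Primes, ∑' e : ℕ, pairFiberSum t ((p : ℕ) ^ e) =
      1 + t (p, 1) + t (1, p) + t (p, p) := by
    intro p
    have h01 : ∀ e : ℕ, e ∉ ({0, 1} : Finset ℕ) → pairFiberSum t ((p : ℕ) ^ e) = 0 := by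
      intro e he
      simp only [Finset.mem_insert, Finset.mem_singleton, not_or] at he
      exact pairFiberSum_prime_pow hsq p.2 (by omega)
    rw [tsum_eq_sum h01, Finset.sum_pair (by norm_num), pow_zero, pow_one, hone,
      pairFiberSum_prime t p.2]
    ring
  have heq : (fun p : Nat.Primes => ∑' e : ℕ, pairFiberSum t ((p : ℕ) ^ e)) =
      fun p : Nat.Primes => 1 + t (p, 1) + t (1, p) + t (p, p) := funext hloc
  rw [heq, (hasSum_pairFiberSum hs.of_norm h0).tsum_eq] at h
  exact h

end Literature.NumberTheory.Sieve.GPY
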